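import Literature.NumberTheory.EllipticCurves.Sprung2012.ColemanMapSurjectiveProofs
import Literature.NumberTheory.EllipticCurves.Sprung2012.ColemanMapLevelCongruenceProofs
import Literature.NumberTheory.EllipticCurves.Sprung2012.LocalIwasawaModule
import Literature.NumberTheory.EllipticCurves.IwasawaAlgebraStructureProofs
import Literature.AnabelianGeometry.EtaleTheta.RootsOfUnityGaloisPrimePower
import HarnessLib

/-!
# Sprung 2012 §§2, 5, 7: the `Λ`-orbit of the Prop. 7.3 functional is FREE over `Λ/ω_2` on the layer `E(K_2·K_v)` —
# `ℤ_p`-rank `p²` of `Hom(E(K_2·K_v), ℤ_p)` from the Coleman map alone (proofs only)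

Topic `Literature/NumberTheory/EllipticCurves`, cluster `Sprung2012` (namespace = path). A THEOREMS file (no definition, no named
fact; net Literature debt `0`). Cell `bsd-ssimc`, width seat `cruxlead-stmt-BirchSwinnertonDyer-19875-w2` (gen 8), `--supports`
stmt-BirchSwinnertonDyer-22569. Step (R1) of the roadmap in `Cruxes/SprungLowerDivisibilityAtThree/Lines/chromatic-common-zeros-COKER-w2g8.md`
towards removing the last hypothesis (a surjection `E(ℚ_{p,2}) ↠ ℤ_p^{p²}`) of `exists_linearMap_isColemanPair_cokernel_of_surjective_rat`
(`Sprung2012/HondaOrbitRankOfSurjectiveProofs.lean`): F. E. I. Sprung, *Iwasawa theory for elliptic curves at supersingular primes: A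
pair of main conjectures*, J. Number Theory **132** (2012) [Sprung2012] — in the tree's functional model (`ColemanMaps.lean`:
`H¹_Iw(T)` = functionals on `E(K_∞·K_v)`, `Λ` acting by `lambdaSMul`, `Col(z) = (L♯, L♭)` iff `IsColemanPair`).

* `not_cyclotomic_sq_dvd` — `Φ_{p²}(1+T) ∤ a_p·α − Φ_p(1+T)·β` in `Λ` when `p ∣ a_p`, `β(0) ∈ ℤ_p^×` (modulo `p`:
  `Φ_{p^{k+1}}(1+T) ≡ T^{p^{k+1}−p^k}`, compare coefficients of `T^{p−1}`); `Φ_{p²}(1+T)` is PRIME in `Λ` (Weierstrass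
  division + Eisenstein: `IwasawaAlgebra.isPrime_span_coe`, `EtaleTheta.irreducible_cyclotomic_prime_pow_comp_padicInt`).
* **`toIwasawa_cyclotomicOmega_two_dvd_of_lambdaSMul_apply_eq_zero`** — for a functional `z₀` with Coleman value `(α, β)`,
  `α ∈ Λˣ`, `β(0) ∈ ℤ_p^×`: **`f • z₀` vanishes on `E(K_2·K_v)` only if `ω_2 ∣ f`** (levels `1` and `2` of Def. 5.9 for
  `Col(f•z₀) = (fα, fβ)`; `ω_2 = ω_1·Φ_{p²}(1+T)`); with the converse `lambdaSMul_apply_eq_zero_of_toIwasawa_cyclotomicOmega_dvd`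
  (`ω_2` kills the layer, `aeval_twistEnd_omega_mul_apply_eq_zero`).
* **`exists_functional_lambdaSMul_apply_layer_two_eq_zero_iff`** — over `ℚ` at an odd good supersingular prime (Honda system,
  local lift `g`): some `z₀` (the functional of the proof of Prop. 7.3, `exists_isColemanPair_isUnit`) has
  `(f•z₀)|_{E(ℚ_{p,2})} = 0 ⟺ ω_2 ∣ f` — so `Λ/ω_2 ≅ ℤ_p^{p²}` EMBEDS into `Hom(E(ℚ_{p,2}), ℤ_p)`: the functionals of the layer
  have `ℤ_p`-rank at least `p² = [ℚ_{p,2} : ℚ_p]`, derived from `E(ℚ_p) ≠ p·E(ℚ_p)` (Milne ADT I.3.3, behind `z₀`) and the `Λ`-linearity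
  of `Col` alone — no formal-group structure of `E(ℚ_{p,2})` is used.
HONEST FRAMING: this is rank on the FUNCTIONAL side; the hypothesis of `…_of_surjective_rat` is rank `p²` MODULO `p` (a surjection
`E(ℚ_{p,2}) ↠ ℤ_p^{p²}`); the `Λ/ω_2`-orbit reduces mod `p` to a `(p²−p+1)`-dimensional space only (`(f•z₀)|₂ ∈ p·Hom ⟺
T^{p²−p+1} ∣ f mod p`), and the missing `p − 1` directions come from the saturation clause (`(T^{p²−p+1}•z₀)|₂ / p`) with
`Φ_{p²}(1) = p` — step (R2), not done here. Nothing about any Selmer group, main conjecture or BSD is asserted.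

References: [Sprung2012] §2 p. 1486, Thm. 2.2 / Lemma 2.3 (p. 1487), Def. 3.1 (p. 1489), Def. 5.9 (p. 1495), Def. 7.1–7.2, Prop. 7.3
(p. 1500), Lemma 7.10 (p. 1503); [Sprung2017] §4 Cor. 4.4 (`u_2, v_2`); [Pollack2003] Thm. 6.17 (`ω_n`); [Washington1997] §7.1, §13.2;
[MilneADT2006] I Lemma 3.3; tree `Sprung2012/{ColemanMaps, ColemanMapSurjectiveProofs, ColemanMapLevelCongruenceProofs,
LocalIwasawaModule, ColemanMapLambdaActionProofs}.lean`, `IwasawaAlgebraStructureProofs`, `AnabelianGeometry/EtaleTheta/RootsOfUnityGaloisPrimePower`.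
-/

noncomputable section

open scoped Classical

open Polynomial Finset

namespace Literature.NumberTheory.EllipticCurves.Sprung2012

open Literature.NumberTheory.EllipticCurves Literature.NumberTheory.GaloisRepresentations ZpExtension
  Literature.NumberTheory.EllipticCurves.Kobayashi2003 Literature.NumberTheory.EllipticCurves.Sprung2017

/-! ## §0 `Φ_{p²}(1+T)` is prime in `Λ` and does not divide `a_p·α − Φ_p(1+T)·β` for `β(0) ∈ ℤ_p^×`, `p ∣ a_p` -/

section Cyclotomic

variable {p : ℕ} [Fact p.Prime]

/-- `Φ_{p^{k+1}}(1+T)` is a prime element of `Λ = ℤ_p⟦T⟧` (distinguished and irreducible over `ℤ_p`; Weierstrass division).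
[cite: Washington1997, §7.1 and §13.2] -/
private theorem prime_toIwasawa_cyclotomic_comp (k : ℕ) :
    Prime (toIwasawa p ((cyclotomic (p ^ (k + 1)) ℤ).comp (X + 1))) := by
  have hmonic : ((cyclotomic (p ^ (k + 1)) ℤ).comp (X + 1)).Monic :=
    (cyclotomic.monic _ ℤ).comp (monic_X_add_C 1) (by rw [← C_1, natDegree_X_add_C]; exact one_ne_zero)
  have hdist : (((cyclotomic (p ^ (k + 1)) ℤ).comp (X + 1)).map (Int.castRingHom ℤ_[p])).IsDistinguishedAt
      (IsLocalRing.maximalIdeal ℤ_[p]) :=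
    { toIsWeaklyEisensteinAt :=
        (Literature.AnabelianGeometry.EtaleTheta.cyclotomic_prime_pow_comp_X_add_one_isEisensteinAt_padicInt
          p k).isWeaklyEisensteinAt
      monic := hmonic.map _ }
  have hI := IwasawaAlgebra.isPrime_span_coe (p := p) hdist
    (Literature.AnabelianGeometry.EtaleTheta.irreducible_cyclotomic_prime_pow_comp_padicInt p k)
  have hne := IwasawaAlgebra.coe_ne_zero_of_monic (p := p) (hmonic.map (Int.castRingHom ℤ_[p]))
  exact (Ideal.span_singleton_prime hne).mp hI

/-- Reduction modulo `p` commutes with the passage `ℤ[X] → Λ`. [folklore] -/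
private theorem map_toZMod_toIwasawa (q : ℤ[X]) :
    PowerSeries.map (PadicInt.toZMod (p := p)) (toIwasawa p q) = ((q.map (Int.castRingHom (ZMod p)) : (ZMod p)[X]) :
      PowerSeries (ZMod p)) := by
  ext n
  rw [PowerSeries.coeff_map, show toIwasawa p q = ((q.map (Int.castRingHom ℤ_[p]) : ℤ_[p][X]) : PowerSeries ℤ_[p]) from rfl,
    Polynomial.coeff_coe, Polynomial.coeff_coe, Polynomial.coeff_map, Polynomial.coeff_map, eq_intCast, eq_intCast,
    map_intCast]

/-- `ω_n ≡ T^{pⁿ} (mod p)`: the reduction of `ω_n = (1+T)^{pⁿ} − 1`. [cite: Pollack2003, Thm. 6.17 (ω_n)] -/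
private theorem map_toZMod_toIwasawa_cyclotomicOmega (n : ℕ) :
    PowerSeries.map (PadicInt.toZMod (p := p)) (toIwasawa p (cyclotomicOmega p n)) = PowerSeries.X ^ p ^ n := by
  rw [map_toZMod_toIwasawa, cyclotomicOmega, Polynomial.map_sub, Polynomial.map_pow, Polynomial.map_add,
    Polynomial.map_X, Polynomial.map_one, add_pow_char_pow, one_pow, add_sub_cancel_right, Polynomial.coe_pow,
    Polynomial.coe_X]

/-- `Φ_{p^{k+1}}(1+T) ≡ T^{p^{k+1} − p^k} (mod p)` (from `ω_{k+1} = ω_k · Φ_{p^{k+1}}(1+T)` reduced mod `p`).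
[cite: Pollack2003, Thm. 6.17 (ω_n)] -/
private theorem map_toZMod_toIwasawa_cyclotomic_comp (k : ℕ) :
    PowerSeries.map (PadicInt.toZMod (p := p)) (toIwasawa p ((cyclotomic (p ^ (k + 1)) ℤ).comp (X + 1))) =
      PowerSeries.X ^ (p ^ (k + 1) - p ^ k) := by
  have hp : p.Prime := Fact.out
  have h := congrArg (fun q ↦ PowerSeries.map (PadicInt.toZMod (p := p)) (toIwasawa p q)) (cyclotomicOmega_succ p k)
  simp only [map_mul, map_toZMod_toIwasawa_cyclotomicOmega] at h
  have hle : p ^ k ≤ p ^ (k + 1) := Nat.pow_le_pow_right hp.pos (Nat.le_succ k)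
  rw [show (PowerSeries.X : PowerSeries (ZMod p)) ^ p ^ (k + 1) = PowerSeries.X ^ p ^ k * PowerSeries.X ^ (p ^ (k + 1) - p ^ k)
    by rw [← pow_add, Nat.add_sub_cancel' hle]] at h
  exact (mul_left_cancel₀ (pow_ne_zero _ PowerSeries.X_ne_zero) h).symm

/-- **`Φ_{p²}(1+T)` does not divide `a_p·α − Φ_p(1+T)·β` when `p ∣ a_p` and `β(0) ∈ ℤ_p^×**: modulo `p` this would read
`T^{p²−p}·H̄ = −T^{p−1}·β̄` with `β̄(0) ≠ 0`, impossible in `𝔽_p⟦T⟧` (compare the coefficients of `T^{p−1}`). [folklore] -/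
private theorem not_cyclotomic_sq_dvd {ap : ℤ} (hap : (p : ℤ) ∣ ap) {α β : IwasawaAlgebra p}
    (hβ : IsUnit (PowerSeries.constantCoeff β)) :
    ¬ toIwasawa p ((cyclotomic (p ^ 2) ℤ).comp (X + 1)) ∣
      PowerSeries.C (ap : ℤ_[p]) * α - toIwasawa p ((cyclotomic p ℤ).comp (X + 1)) * β := by
  have hp : p.Prime := Fact.out
  rintro ⟨H, hH⟩
  have hlt : ¬ (p ^ (1 + 1) - p ≤ p - 1) := by
    have h2 : 2 * p ≤ p ^ (1 + 1) := by
      rw [show p ^ (1 + 1) = p * p by ring]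
      exact Nat.mul_le_mul_right p hp.two_le
    have h1 := hp.pos
    generalize p ^ (1 + 1) = s at h2 ⊢
    omega
  have h := congrArg (fun F ↦ PowerSeries.coeff (p - 1) (PowerSeries.map (PadicInt.toZMod (p := p)) F)) hH
  simp only [map_sub, map_mul] at h
  rw [show (cyclotomic (p ^ 2) ℤ) = cyclotomic (p ^ (1 + 1)) ℤ by norm_num, map_toZMod_toIwasawa_cyclotomic_comp,
    show (cyclotomic p ℤ) = cyclotomic (p ^ (0 + 1)) ℤ by rw [zero_add, pow_one], map_toZMod_toIwasawa_cyclotomic_comp,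
    PowerSeries.map_C, pow_zero, zero_add, pow_one, PowerSeries.coeff_C_mul, PowerSeries.coeff_X_pow_mul',
    PowerSeries.coeff_X_pow_mul', if_pos le_rfl, Nat.sub_self, if_neg hlt] at h
  -- `h : toZMod ap * _ - (map toZMod β) 0 = 0`
  obtain ⟨b, hb⟩ := hap
  rw [hb, Int.cast_mul, Int.cast_natCast, map_mul, map_natCast, ZMod.natCast_self, zero_mul, zero_mul, zero_sub,
    neg_eq_zero, PowerSeries.coeff_map, PowerSeries.coeff_zero_eq_constantCoeff_apply] at h
  -- `p ∣ β(0)`, contradicting the unit hypothesis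
  have hdvd : (p : ℤ_[p]) ∣ PowerSeries.constantCoeff β := by
    rw [← RingHom.mem_ker, PadicInt.ker_toZMod, PadicInt.maximalIdeal_eq_span_p, Ideal.mem_span_singleton] at h
    exact h
  rw [PadicInt.isUnit_iff] at hβ
  exact (PadicInt.norm_lt_one_iff_dvd _ |>.mpr hdvd).ne hβ

/-- `ω_n ≠ 0` in `Λ` (its reduction mod `p` is `T^{pⁿ}`). [cite: Pollack2003, Thm. 6.17 (ω_n)] -/
private theorem toIwasawa_cyclotomicOmega_ne_zero (n : ℕ) : toIwasawa p (cyclotomicOmega p n) ≠ 0 := by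
  intro h
  have h' := congrArg (PowerSeries.map (PadicInt.toZMod (p := p))) h
  rw [map_toZMod_toIwasawa_cyclotomicOmega, map_zero] at h'
  exact pow_ne_zero _ PowerSeries.X_ne_zero h'

end Cyclotomic

/-! ## §1 `f • z₀` vanishes on `E(K_2·K_v)` only if `ω_2 ∣ f` -/

section Local

universe u

variable {K : Type u} [Field K] {p : ℕ} [Fact p.Prime] (κ : ZpExtension K p)
variable {E : Type u} [Field E] [Algebra K E] (ι : AlgebraicClosure K →ₐ[K] AlgebraicClosure E)
variable (W : WeierstrassCurve K)

variable {κ ι W}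

/-- **The `Λ`-orbit of a functional with unit Coleman values is free over `Λ/ω_2` on the layer `E(K_2·K_v)`.** Let `z₀`
be a functional on `E(K_∞·K_v)` with Coleman value `(α, β)`, `α ∈ Λˣ` and `β(0) ∈ ℤ_p^×` (e.g. the functional of the proof
of Prop. 7.3, `exists_isColemanPair_isUnit`), `p ∣ a_p`. If `f • z₀` (the action `lambdaSMul`, `γ ↦ 1 + T`) vanishes on
`E(K_2·K_v)`, then `ω_2 ∣ f`. PROOF: `Col(f•z₀) = (fα, fβ)` (`isColemanPair_lambdaSMul`) and the pairing sums of
`f•z₀` at points of the layer vanish, so level `1` of the Coleman characterisation gives `ω_1 ∣ fα`, i.e. `f = ω_1 f₁`, and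
level `2` (`u_2 = a_p`, `v_2 = −Φ_p(1+T)`) gives `ω_2 = ω_1Φ_{p²}(1+T) ∣ f·(a_pα − Φ_p(1+T)β)`, so the PRIME
`Φ_{p²}(1+T)` divides `f₁` (it cannot divide `a_pα − Φ_p(1+T)β`: `not_cyclotomic_sq_dvd`). CONSEQUENCE: `f ↦ (f•z₀)|_{E(K_2·K_v)}`
embeds `Λ/ω_2 ≅ ℤ_p^{p²}` into the functionals of the layer — the `ℤ_p`-rank `p² = [ℚ_{p,2} : ℚ_p]` of `Hom(E(K_2·K_v), ℤ_p)`
obtained from the Coleman map alone (the level-`0` input being `E(K_v) ≠ p·E(K_v)` behind `z₀`).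
[cite: Sprung2012, Def. 5.9 (p. 1495), Def. 7.1–7.2 and proof of Prop. 7.3 (p. 1500), Lemma 7.10 (p. 1503)] [cite: Sprung2017, §4 Cor. 4.4] -/
theorem toIwasawa_cyclotomicOmega_two_dvd_of_lambdaSMul_apply_eq_zero {ap : ℤ} (hap : (p : ℤ) ∣ ap)
    {g : Field.absoluteGaloisGroup E} (hg : κ.IsTopGenerator (resGalOfEmb ι g)) {c : ℕ → localPoints W E}
    (hc : ∀ n, c n ∈ localLayerPointsOfEmb κ ι W n) {z₀ : localTowerPointsOfEmb κ ι W →+ ℤ_[p]}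
    {α β : IwasawaAlgebra p} (h₀ : IsColemanPair κ ι W ap g c z₀ α β) (hα : IsUnit α)
    (hβ : IsUnit (PowerSeries.constantCoeff β)) (f : IwasawaAlgebra p)
    (hf : ∀ (x : localPoints W E) (hx : x ∈ localLayerPointsOfEmb κ ι W 2),
      lambdaSMul κ ι W hg f z₀ ⟨x, localLayerPointsOfEmb_le_localTowerPointsOfEmb κ ι W 2 hx⟩ = 0) :
    toIwasawa p (cyclotomicOmega p 2) ∣ f := by
  have hfz := isColemanPair_lambdaSMul hg hc h₀ f
  -- the pairing sums of `f • z₀` at points of the layer vanish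
  have hP : ∀ (n : ℕ) {x : localPoints W E}, x ∈ localLayerPointsOfEmb κ ι W 2 →
      pairingSum W (localTowerPointsOfEmb κ ι W) g n x (lambdaSMul κ ι W hg f z₀) = 0 := by
    intro n x hx
    rw [pairingSum_def]
    refine sum_eq_zero fun j _ ↦ ?_
    have hjx : g ^ j • x ∈ localLayerPointsOfEmb κ ι W 2 := smul_mem_localLayerPointsOfEmb κ ι W 2 _ hx
    rw [evalOn_of_mem W _ _ (localLayerPointsOfEmb_le_localTowerPointsOfEmb κ ι W 2 hjx), hf _ hjx, map_zero, zero_mul]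
  have hc1 : c 1 ∈ localLayerPointsOfEmb κ ι W 2 := localLayerPointsOfEmb_mono κ ι W (by norm_num : 1 ≤ 2) (hc 1)
  -- level 1: `ω_1 ∣ f α`, hence `ω_1 ∣ f`
  have h1 := hfz 1
  rw [sharpPoly_one, flatPoly_one, map_one, map_zero, one_mul, zero_mul, add_zero, hP 1 hc1, zero_add] at h1
  obtain ⟨f₁, hf₁⟩ := (hα.dvd_mul_right).mp h1
  -- level 2: `ω_2 ∣ f (a_p α − Φ_p(1+T) β)`
  have h2 := hfz 2
  rw [sharpPoly_two, flatPoly_two, pow_one, map_neg, hP 2 (hc 2), zero_add,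
    show toIwasawa p (C ap) = PowerSeries.C (ap : ℤ_[p]) by
      rw [show toIwasawa p (C ap) = (((C ap : ℤ[X]).map (Int.castRingHom ℤ_[p]) : ℤ_[p][X]) : PowerSeries ℤ_[p]) from rfl,
        Polynomial.map_C, eq_intCast, Polynomial.coe_C],
    show PowerSeries.C (ap : ℤ_[p]) * (f * α) + -toIwasawa p ((cyclotomic p ℤ).comp (X + 1)) * (f * β) =
      f * (PowerSeries.C (ap : ℤ_[p]) * α - toIwasawa p ((cyclotomic p ℤ).comp (X + 1)) * β) by ring,
    hf₁, mul_assoc] at h2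
  -- `ω_2 = ω_1 · Φ_{p²}(1+T)`; cancel `ω_1`
  have hω : toIwasawa p (cyclotomicOmega p 2) =
      toIwasawa p (cyclotomicOmega p 1) * toIwasawa p ((cyclotomic (p ^ 2) ℤ).comp (X + 1)) := by
    rw [← map_mul, show (2 : ℕ) = 1 + 1 from rfl, cyclotomicOmega_succ]
  rw [hω, mul_dvd_mul_iff_left (toIwasawa_cyclotomicOmega_ne_zero 1)] at h2
  have hprime : Prime (toIwasawa p ((cyclotomic (p ^ 2) ℤ).comp (X + 1))) := prime_toIwasawa_cyclotomic_comp (p := p) 1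
  rcases hprime.dvd_or_dvd h2 with hd | hd
  · rw [hf₁, hω]
    exact mul_dvd_mul_left _ hd
  · exact absurd hd (not_cyclotomic_sq_dvd hap hβ)

/-- The converse: `ω_2 • z` vanishes on `E(K_2·K_v)` for every `z` (`ω_2` acts as `Θ^{p²} − 1` and `g^{p²}` fixes the layer);
hence so does `f • z` whenever `ω_2 ∣ f`. [cite: Sprung2012, §2 p. 1486 and Def. 3.1 (p. 1489)] -/
theorem lambdaSMul_apply_eq_zero_of_toIwasawa_cyclotomicOmega_dvd {g : Field.absoluteGaloisGroup E}
    (hg : κ.IsTopGenerator (resGalOfEmb ι g)) (z : localTowerPointsOfEmb κ ι W →+ ℤ_[p]) {f : IwasawaAlgebra p}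
    (hf : toIwasawa p (cyclotomicOmega p 2) ∣ f) (x : localPoints W E) (hx : x ∈ localLayerPointsOfEmb κ ι W 2) :
    lambdaSMul κ ι W hg f z ⟨x, localLayerPointsOfEmb_le_localTowerPointsOfEmb κ ι W 2 hx⟩ = 0 := by
  obtain ⟨s, rfl⟩ := hf
  -- a polynomial representative of `s` modulo `ω_2`
  have hr := toIwasawa_dvd_sub_polyRep 2 s
  set r := polyRep p 2 s with hrdef
  have hrep : toIwasawa p (cyclotomicOmega p 2) ∣ toIwasawa p (cyclotomicOmega p 2) * s -
      ((((X + 1 : ℤ_[p][X]) ^ p ^ 2 - 1) * r : ℤ_[p][X]) : PowerSeries ℤ_[p]) := by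
    rw [Polynomial.coe_mul, ← toIwasawa_cyclotomicOmega_eq_coe, ← mul_sub]
    exact dvd_mul_of_dvd_left (dvd_refl _) _ |>.trans (mul_dvd_mul_left _ hr) |> fun h ↦ by
      rw [mul_sub]; rw [mul_sub] at h; exact h
  rw [lambdaSMul_apply_eq_aeval hg _ z hrep hx]
  exact aeval_twistEnd_omega_mul_apply_eq_zero hg (twistEnd_apply κ ι W g) 2 r z hx

end Local

/-! ## §2 Over `ℚ`: the functional of Prop. 7.3 -/

section Rat

open NumberField IsDedekindDomain

/-- **`Λ/ω_2 ↪ Hom(E(ℚ_{p,2}), ℤ_p)` over `ℚ` at an odd supersingular prime.** There is a functional `z₀` on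
`E(ℚ_∞·ℚ_p)` (that of the proof of Prop. 7.3) such that, for `f ∈ Λ`, `f • z₀` vanishes on the layer `E(ℚ_p·ℚ_2)` if and
only if `ω_2 ∣ f`: the restrictions `(f • z₀)|_{E(ℚ_{p,2})}`, `f ∈ Λ/ω_2`, form a copy of `Λ/ω_2 ≅ ℤ_p^{p²}` inside
`Hom(E(ℚ_{p,2}), ℤ_p)` — rank `p² = [ℚ_{p,2} : ℚ_p]` on the functional side, from `E(ℚ_p) ≠ p·E(ℚ_p)` (Milne ADT I.3.3) and the
Coleman map alone. (What item (α) still needs beyond this — the same rank modulo `p`, i.e. a surjection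
`E(ℚ_{p,2}) ↠ ℤ_p^{p²}` — is the hypothesis of `exists_linearMap_isColemanPair_cokernel_of_surjective_rat`.)
[cite: Sprung2012, proof of Prop. 7.3 (p. 1500), Def. 5.9 (p. 1495), Thm. 2.2 and Lemma 2.3 (p. 1487)] -/
theorem exists_functional_lambdaSMul_apply_layer_two_eq_zero_iff (W : WeierstrassCurve ℚ) [W.IsElliptic]
    [W.IsGloballyMinimal] (p : ℕ) [Fact p.Prime] (hp2 : p ≠ 2) (hgood : W.HasGoodReductionAtPrime p)
    (hap : (p : ℤ) ∣ W.frobeniusTrace p) (κ : ZpExtension ℚ p) {v : HeightOneSpectrum (𝓞 ℚ)} (hpv : (p : 𝓞 ℚ) ∈ v.asIdeal)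
    {g : Field.absoluteGaloisGroup (v.adicCompletion ℚ)}
    (hg : κ.IsTopGenerator (resGalOfEmb (closureEmb (K := ℚ) (v.adicCompletion ℚ)) g))
    {cneg : localPoints W (v.adicCompletion ℚ)} {c : ℕ → localPoints W (v.adicCompletion ℚ)}
    (hH : IsHondaSystem κ (closureEmb (K := ℚ) (v.adicCompletion ℚ)) W (W.frobeniusTrace p) g cneg c) :
    ∃ z₀ : localTowerPointsOfEmb κ (closureEmb (K := ℚ) (v.adicCompletion ℚ)) W →+ ℤ_[p],
      ∀ f : IwasawaAlgebra p,
        (∀ (x : localPoints W (v.adicCompletion ℚ))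
            (hx : x ∈ localLayerPointsOfEmb κ (closureEmb (K := ℚ) (v.adicCompletion ℚ)) W 2),
            lambdaSMul κ (closureEmb (K := ℚ) (v.adicCompletion ℚ)) W hg f z₀
              ⟨x, localLayerPointsOfEmb_le_localTowerPointsOfEmb κ _ W 2 hx⟩ = 0) ↔
          toIwasawa p (cyclotomicOmega p 2) ∣ f := by
  obtain ⟨z₀, Ls, Lf, hCP, hLs, hLf⟩ := exists_isColemanPair_isUnit W p hp2 hgood hap κ hpv _ hg hH
  refine ⟨z₀, fun f ↦ ⟨fun hf ↦ ?_, fun hf x hx ↦ ?_⟩⟩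
  · exact toIwasawa_cyclotomicOmega_two_dvd_of_lambdaSMul_apply_eq_zero hap hg hH.2.1 hCP hLs
      (PowerSeries.isUnit_iff_constantCoeff.mp hLf) f hf
  · exact lambdaSMul_apply_eq_zero_of_toIwasawa_cyclotomicOmega_dvd hg z₀ hf x hx

end Rat

end Literature.NumberTheory.EllipticCurves.Sprung2012

end
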